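import Literature.AlgebraicGeometry.HodgeTheory.GriffithsResiduesPoleOrderOneExact
import Literature.AlgebraicGeometry.HodgeTheory.SmoothHypersurfaceGeometricGenusLowerBound
import Literature.AlgebraicGeometry.HodgeTheory.FermatOddMiddleBettiNumber
import Literature.AlgebraicGeometry.HodgeTheory.MonomialSupportedHypersurfaceEquivariantBetti
import Literature.AlgebraicGeometry.HodgeTheory.BettiUniverseEigenspacePieces
import Literature.AlgebraicGeometry.HodgeTheory.HypersurfaceEigenHodgeNumbersJacobianOfResidues
import Summits.HodgeConjecture.HodgeConjecture.Theorems.SignSymmetricPowersSignFermatCount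
import HarnessLib

/-!
# The `ι`-eigen-Hodge numbers of a smooth sign-symmetric threefold from the GEOMETRIC GENUS alone
# (route `SignSymmetricPowers`, item stmt-HodgeConjecture-19716, binder hV; cell `hodge-nonav`)

Prover seat `hodge-nonav-19716-p2` (g5). Landed `--supports stmt-HodgeConjecture-19716 --as helper`; sorry-free, no
definition, no new named fact; CONDITIONAL on ONE cited fact, the geometric genus of smooth hypersurfaces
`Arapura2012_hypersurface_geometricGenus` (PG, already a registered binder of the sister crux K1-A, stmt-19544). Nothing
here says HC ∕ HC_AV is proved; rung F-H1 is not moved.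

## What is proved

For an even `d ≥ 4`, a nonsingular quinary form `f` of degree `d` all of whose monomials have `e₀ + e₁` even
(`ι`-even, `ι = diag(−1,−1,1,1,1)` = `signInvolutionVector`), `X_f = V₊(f) ⊂ ℙ⁴` smooth projective, `j < 2` and
`q ≤ 3`:

  `dim_ℂ (E_{(−1)^j}(ι^* ⊗ ℂ) ∩ H^{3−q,q}(X_f)) = #{β ∈ [0, d−2]⁵ : |β| = (q+1)d − 5, ι^β = (−1)^j}`

(`finrank_signEigenspace_inf_piece_of_geometricGenus`; the right side read as `0` when `(q+1)d < 5`). This is the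
K1-B instance of Voisin's equivariant Jacobian-ring statement (the binder hV,
`voisin2003_finrank_eigenspace_inf_hodgePiece_of_diagonalStabilizer`, Voisin II Cor. 6.12 read equivariantly) in its
box-count form (the tree's sign-refined Macaulay theorem `hilbertSign_jacobianIdeal_eq_card` identifies the box count
with `dim (R_f^{(q+1)d−5})_{(−1)^j}`), obtained WITHOUT Griffiths' residues beyond pole order one:

* `q = 0`: residues at pole order one (`finrank_eigenspace_inf_piece_eq_of_finrank_piece_le`, tree theorem) exhaust
  `H^{3,0}` granted PG's `h^{3,0} ≤ C(d−1,4)`; `dim (S^{d−5})_± = #{β : |β| = d−5, ι^β = ±1}`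
  (`finrank_homogeneousSubmodule_inf_eigenspace`).
* `q = 3`: Hodge symmetry with eigenvalues (`BettiUniverse.finrank_eigenspace_inf_piece_symm`) and the complement
  symmetry of the box (`card_boxFilter_eq_of_add_eq`).
* `q = 1, 2`: `b₃^±(X_f) := dim E_±(ι^*) = Σ_q dim (E_± ∩ H^{3−q,q})` (`BettiUniverse.finrank_eigenspace_baseChange_pull_eq_sum`);
  `b₃^±(X_f) = b₃^±(X³_d)` by EQUIVARIANT Ehresmann on the `ι`-even family
  (`finrank_eigenspace_diagonalPullback_eq_of_isSupportedOn`); at the Fermat threefold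
  `b₃^± = #{α ∈ 𝔄³_d : χ_α(ι) = ±1}` (`finrank_eigenspace_diagonalPullback_fermat_odd_eq_card`, which rests on the
  odd-dimensional nonvanishing `fermatEigenspace_ne_bot_odd`) `= Σ_{q<4} box(q)` (Shioda's dictionary,
  `card_admissible_character_eq_sum_boxFilter`) `= 2 box(0) + 2 box(1)`; with `h^{2,1}_± = h^{1,2}_±` this solves to
  `box(1)`.

The companion file in the Theses cone turns the box count into the line's closed form `shn d j q` and re-composes the
crux: K1-B ⟸ {PG, hPL, h423, hCDK, hA3}.

## References

* [VoisinHodgeII2003] C. Voisin, Hodge Theory and Complex Algebraic Geometry II (2003), §6.1.3 Thm. 6.10 ∕ Cor. 6.12.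
* [Arapura2012] D. Arapura, Algebraic Geometry over the Complex Numbers (2012), §17.3 (17.3.1), Cor. 17.3.5.
* [Shioda1979HodgeFermat] T. Shioda, The Hodge conjecture for Fermat varieties, Math. Ann. 245 (1979), §1 (1.3)–(1.7).
* [Katz2009] N. M. Katz, Another look at the Dwork family (2009), §3 Lemma 3.1(1).
* [CarlsonMullerStachPeters2017] J. Carlson, S. Müller-Stach, C. Peters, Period Mappings and Period Domains (2017), §7.4.
-/

noncomputable section

open Finset MvPolynomial CategoryTheory
open Literature.AlgebraicGeometry.Motives Literature.AlgebraicGeometry.HodgeTheory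
open Literature.AlgebraicGeometry.HodgeTheory.BettiUniverse
open Literature.AlgebraicGeometry.Motives.UniversalHypersurface
open Literature.AlgebraicTopology.SingularHomology

-- mandated namespace `Summit.HodgeConjecture.HodgeConjecture.Theorems` trips `linter.dupNamespace` (off tree-wide)
set_option linter.dupNamespace false

namespace Summit.HodgeConjecture.HodgeConjecture.Theorems.SignSymmetricPowersSignEigenHodgeOfGeometricGenus

open Summit.HodgeConjecture.HodgeConjecture.Theorems.SignSymmetricPowersSignFermatCount

/-! ### §1 The sign vector `ι` -/

/-- `ιᵢᵈ = 1` for even `d`: `ι ∈ μ_d⁵`. [cite: Shioda1979HodgeFermat, §1] -/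
theorem signInvolutionVector_mem_fermatGroup {d : ℕ} (hd : Even d) : signInvolutionVector ∈ fermatGroup 3 d := by
  rw [mem_fermatGroup_iff]
  intro i
  simp only [signInvolutionVector]
  split_ifs
  · exact hd.neg_one_pow
  · exact one_pow _

/-- `γ^m` (the tree's `unitWeight`) is the monomial weight `∏ γᵢ^{mᵢ}`. [cite: Katz2009, §3] -/
theorem unitWeight_coe_eq_prod {n : ℕ} (γ : Fin (n + 2) → ℂˣ) (m : Fin (n + 2) →₀ ℕ) :
    ((unitWeight ℂ n γ m : ℂˣ) : ℂ) = ∏ i, ((γ i : ℂˣ) : ℂ) ^ m i := by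
  rw [unitWeight_coe, Finsupp.prod_fintype _ _ (fun i ↦ pow_zero _)]

/-- **A form fixed by a diagonal `γ` is supported on the monomials fixed by `γ`** (`coeff_m G(γ • x) = γ^m coeff_m G`).
[cite: Katz2009, §3] -/
theorem isSupportedOn_fixed_of_mem_diagonalStabilizer {n d : ℕ} {γ : Fin (n + 2) → ℂˣ}
    {G : MvPolynomial (Fin (n + 2)) ℂ} (hG : γ ∈ diagonalStabilizer G) :
    IsSupportedOn n d {m : DegIndex n d | unitWeight ℂ n γ m.1 = 1} G := by
  intro m hm
  simp only [Set.mem_setOf_eq] at hm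
  have h := coeff_aeval_diagonalSubst γ m.1 G
  rw [mem_diagonalStabilizer_iff.mp hG] at h
  have hne : (∏ i, ((γ i : ℂˣ) : ℂ) ^ m.1 i) ≠ 1 := by
    rw [← unitWeight_coe_eq_prod]
    exact fun h1 ↦ hm (Units.val_eq_one.mp h1)
  have h' : ((∏ i, ((γ i : ℂˣ) : ℂ) ^ m.1 i) - 1) * coeff m.1 G = 0 := by rw [sub_mul, ← h, one_mul, sub_self]
  exact (mul_eq_zero.mp h').resolve_left (sub_ne_zero.mpr hne)

/-! ### §2 `b₃^±` of a smooth `ι`-even threefold, read at the Fermat threefold -/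

/-- **`b₃^{±}(X_f) = #{α ∈ 𝔄³_d : χ_α(ι) = ±1}`** for a smooth `ι`-even quinary form of even degree `d ≥ 2` (more generally
for any `c`: `dim ker (ι_f^* ⊗ ℂ − c) = #{α ∈ 𝔄³_d : χ_α(ι) = c}`): complexification
(`finrank_eigenspace_baseChange_pull_eq_complexBetti`), EQUIVARIANT Ehresmann to the Fermat threefold on the family of
nonsingular `ι`-even forms (`finrank_eigenspace_diagonalPullback_eq_of_isSupportedOn`), and the Fermat count
(`finrank_eigenspace_diagonalPullback_fermat_odd_eq_card`). [cite: Katz2009, §3 Lemma 3.1(1)]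
[cite: Shioda1979HodgeFermat, §1 (1.3)–(1.4)] -/
theorem finrank_signEigenspace_eq_card_admissible {d : ℕ} [NeZero d] (hd : Even d)
    (f : MvPolynomial (Fin 5) ℂ) (hf : f.IsHomogeneous d) (hns : SmoothHypersurface.IsNonsingularForm ℂ f)
    (hXF : IsSmoothProjective 3 (SmoothHypersurface.hypersurface f)) (ha : signInvolutionVector ∈ diagonalStabilizer f)
    (c : ℂ) :
    Module.finrank ℂ ↥(Module.End.eigenspace ((pull (diagonalAut f ha) 3).baseChange ℂ) c) =
      Fintype.card {α : Fin (3 + 2) → ZMod d //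
        ((fermatCharacter d α ⟨signInvolutionVector, signInvolutionVector_mem_fermatGroup hd⟩ : ℂˣ) : ℂ) = c ∧
          (∀ i, α i ≠ 0) ∧ ∑ i, α i = 0} := by
  have hd1 : 1 ≤ d := NeZero.one_le
  set M : Set (DegIndex 3 d) := {m | unitWeight ℂ 3 signInvolutionVector m.1 = 1} with hM
  have hγ : FixesMonomials ℂ 3 d M signInvolutionVector := fun m hm ↦ hm
  have hF : (fermatPolynomial ℂ 3 d).IsHomogeneous d := isHomogeneous_fermatPolynomial 3 d
  have hFns : SmoothHypersurface.IsNonsingularForm ℂ (fermatPolynomial ℂ 3 d) :=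
    SmoothHypersurface.isNonsingularForm_sum_X_pow (Nat.cast_ne_zero.mpr (NeZero.ne d))
  have haF : signInvolutionVector ∈ diagonalStabilizer (fermatPolynomial ℂ 3 d) :=
    fermatGroup_le_diagonalStabilizer d (signInvolutionVector_mem_fermatGroup hd)
  have hXFermat : IsSmoothProjective 3 (SmoothHypersurface.hypersurface (fermatPolynomial ℂ 3 d)) :=
    isSmoothProjective_fermatHypersurface (by norm_num) hd1
  rw [finrank_eigenspace_baseChange_pull_eq_complexBetti hXF (diagonalAut f ha) 3 c]
  have h1 : Module.finrank ℂ ↥(Module.End.eigenspace (complexBetti.map (diagonalAut f ha) 3).hom c) =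
      Module.finrank ℂ ↥(Module.End.eigenspace (diagonalPullback f ha 3) c) := rfl
  rw [h1, finrank_eigenspace_diagonalPullback_eq_of_isSupportedOn M (by norm_num) hd1 hγ hf hns
    (isSupportedOn_fixed_of_mem_diagonalStabilizer ha) ha hXF hF hFns
    (isSupportedOn_fixed_of_mem_diagonalStabilizer haF) haF hXFermat 3 c]
  exact finrank_eigenspace_diagonalPullback_fermat_odd_eq_card (m := d) (p := 1) le_rfl
    ⟨signInvolutionVector, signInvolutionVector_mem_fermatGroup hd⟩ c

/-! ### §3 `H^{3,0}`: residues at pole order one, granted the geometric genus -/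

/-- **`dim (E_c ∩ H^{3,0}(X_f)) = #{β ∈ [0,d−2]⁵ : |β| = d − 5, ι^β = c}`** (`0` for `d < 5`), `c = ±1`, granted PG:
for `d ≥ 5` the residues `Res(PΩ/f)`, `deg P = d − 5`, exhaust `H^{3,0}` (PG gives `h^{3,0} ≤ C(d−1,4) = dim S^{d−5}`;
`finrank_eigenspace_inf_piece_eq_of_finrank_piece_le`) equivariantly, and `(S^{d−5})_c` is counted by monomials
(`finrank_homogeneousSubmodule_inf_eigenspace`; the box bound `βᵢ ≤ d − 2` is automatic in degree `d − 5`); for `d = 4`,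
`h^{3,0} = C(3,4) = 0`. [cite: VoisinHodgeII2003, §6.1.3 Cor. 6.12 (p = 1)] [cite: Arapura2012, §17.3 (17.3.1)] -/
theorem finrank_signEigenspace_inf_piece_three_zero_of_geometricGenus
    (hPG : Arapura2012_hypersurface_geometricGenus) {d : ℕ} (h4 : 4 ≤ d)
    (f : MvPolynomial (Fin 5) ℂ) (hf : f.IsHomogeneous d) (hns : SmoothHypersurface.IsNonsingularForm ℂ f)
    (hXF : IsSmoothProjective 3 (SmoothHypersurface.hypersurface f)) (ha : signInvolutionVector ∈ diagonalStabilizer f)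
    (c : ℂ) :
    Module.finrank ℂ ↥(Module.End.eigenspace ((pull (diagonalAut f ha) 3).baseChange ℂ) c ⊓
        (hodge exists_isReal_hodgeModel_holds hXF 3).piece 3 0) =
      if (0 + 1) * d < 5 then 0 else
        (((univ : Finset (Fin 5)).finsuppAntidiag ((0 + 1) * d - 5)).filter
          fun β : Fin 5 →₀ ℕ ↦ (∀ i, β i ≤ d - 2) ∧
            (∏ i, ((signInvolutionVector i : ℂˣ) : ℂ) ^ β i) = c).card := by
  classical
  by_cases hd5 : d < 5
  · -- `d = 4`: `h^{3,0} = C(3,4) = 0`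
    rw [if_pos (by omega)]
    have hpg : Module.finrank ℂ ↥((hodge exists_isReal_hodgeModel_holds hXF 3).piece ((3 : ℕ) : ℤ) 0) = 0 := by
      rw [hPG exists_isReal_hodgeModel_holds (n := 3) (d := d) (by norm_num) (by omega) f hf hns hXF]
      have : d = 4 := by omega
      subst this
      rfl
    haveI : Module.Finite ℚ ↥(bettiCohomology (SmoothHypersurface.hypersurface f) 3) := BettiUniverse.finite hXF 3
    refine le_antisymm ?_ (Nat.zero_le _)
    calc Module.finrank ℂ ↥(Module.End.eigenspace ((pull (diagonalAut f ha) 3).baseChange ℂ) c ⊓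
            (hodge exists_isReal_hodgeModel_holds hXF 3).piece 3 0)
        ≤ Module.finrank ℂ ↥((hodge exists_isReal_hodgeModel_holds hXF 3).piece ((3 : ℕ) : ℤ) 0) :=
          Submodule.finrank_mono inf_le_right
      _ = 0 := hpg
  · -- `d ≥ 5`: residues at pole order one exhaust `H^{3,0}`
    rw [if_neg (by omega)]
    have hd5' : 3 + 2 ≤ d := by omega
    have hpg := finrank_piece_le_finrank_homogeneousSubmodule_of_geometricGenus hPG exists_isReal_hodgeModel_holds
      (n := 3) (by norm_num) hd5' hf hns hXF
    have h := finrank_eigenspace_inf_piece_eq_of_finrank_piece_le exists_isReal_hodgeModel_holds (n := 3) (by norm_num)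
      hd5' hf hns hXF hpg ha c
    have h' : Module.finrank ℂ ↥(Module.End.eigenspace ((pull (diagonalAut f ha) 3).baseChange ℂ) c ⊓
        (hodge exists_isReal_hodgeModel_holds hXF 3).piece 3 0) =
        Module.finrank ℂ ↥(Module.End.eigenspace (twistedDiagonalAction signInvolutionVector) c ⊓
          homogeneousSubmodule (Fin 5) ℂ (d - 5)) := h
    rw [h', ← eigenspace_aeval_diagonalSubst_eq_eigenspace_twistedDiagonalAction, prod_signInvolutionVector, inv_one,
      mul_one, inf_comm]
    have hcount : Module.finrank ℂ ↥(homogeneousSubmodule (Fin 5) ℂ (d - 5) ⊓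
        Module.End.eigenspace (aeval (diagonalSubst signInvolutionVector)).toLinearMap c) =
        (((univ : Finset (Fin 5)).finsuppAntidiag (d - 5)).filter
          fun β : Fin 5 →₀ ℕ ↦ (∏ i, ((signInvolutionVector i : ℂˣ) : ℂ) ^ β i) = c).card :=
      finrank_homogeneousSubmodule_inf_eigenspace (n := 3) signInvolutionVector c (d - 5)
    rw [hcount, show (0 + 1) * d - 5 = d - 5 by omega]
    refine congrArg Finset.card (Finset.filter_congr fun β hβ ↦ ?_)
    rw [mem_finsuppAntidiag] at hβ
    refine ⟨fun h ↦ ⟨fun i ↦ ?_, h⟩, fun h ↦ h.2⟩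
    have hi : β i ≤ (univ : Finset (Fin 5)).sum ⇑β :=
      Finset.single_le_sum (f := ⇑β) (fun _ _ ↦ Nat.zero_le _) (Finset.mem_univ i)
    omega

/-! ### §4 The eigen-Hodge numbers from the geometric genus -/

/-- **The `ι`-eigen-Hodge numbers of a smooth sign-symmetric threefold from the geometric genus** (the K1-B instance of
the binder hV in box-count form): for even `d ≥ 4`, a nonsingular `ι`-invariant quinary form `f` of degree `d` with
`X_f` smooth projective, `j < 2`, `q ≤ 3`:
`dim_ℂ (E_{(−1)^j}(ι^* ⊗ ℂ) ∩ H^{3−q,q}(X_f)) = #{β ∈ [0,d−2]⁵ : |β| = (q+1)d − 5, ι^β = (−1)^j}` (`0` if `(q+1)d < 5`).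
`q = 0` by residues at pole order one + PG; `q = 3` by Hodge symmetry; `q = 1, 2` from `b₃^± =
Σ_q h^{3−q,q}_±`, `b₃^±(X_f) = b₃^±(X³_d) = #{α ∈ 𝔄³_d : χ_α(ι) = ±1} = Σ_q box(q)` and the two symmetries.
CONDITIONAL on PG only. [cite: VoisinHodgeII2003, §6.1.3 Cor. 6.12] [cite: Arapura2012, §17.3 (17.3.1)]
[cite: Shioda1979HodgeFermat, §1 (1.3)–(1.7)] [cite: Katz2009, §3 Lemma 3.1(1)] -/
theorem finrank_signEigenspace_inf_piece_of_geometricGenus (hPG : Arapura2012_hypersurface_geometricGenus)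
    ⦃d : ℕ⦄ (hd : Even d) (h4 : 4 ≤ d) (f : MvPolynomial (Fin 5) ℂ) (hf : f.IsHomogeneous d)
    (hns : SmoothHypersurface.IsNonsingularForm ℂ f) (hXF : IsSmoothProjective 3 (SmoothHypersurface.hypersurface f))
    (ha : signInvolutionVector ∈ diagonalStabilizer f) {j q : ℕ} (hj : j < 2) (hq : q ≤ 3) :
    Module.finrank ℂ ↥(Module.End.eigenspace ((pull (diagonalAut f ha) 3).baseChange ℂ) ((-1 : ℂ) ^ j) ⊓
        (hodge exists_isReal_hodgeModel_holds hXF 3).piece ((3 : ℤ) - q) q) =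
      if (q + 1) * d < 5 then 0 else
        (((univ : Finset (Fin 5)).finsuppAntidiag ((q + 1) * d - 5)).filter
          fun β : Fin 5 →₀ ℕ ↦ (∀ i, β i ≤ d - 2) ∧
            (∏ i, ((signInvolutionVector i : ℂˣ) : ℂ) ^ β i) = (-1 : ℂ) ^ j).card := by
  classical
  have h2 : 2 ≤ d := by omega
  haveI : NeZero d := ⟨by omega⟩
  set c : ℂ := (-1 : ℂ) ^ j with hcdef
  have hc : c = 1 ∨ c = -1 := by
    obtain rfl | rfl : j = 0 ∨ j = 1 := by omega
    · exact Or.inl (pow_zero _)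
    · exact Or.inr (pow_one _)
  have hconj : starRingEnd ℂ c = c := by
    rcases hc with h | h <;> rw [h] <;> simp
  set H := hodge exists_isReal_hodgeModel_holds hXF 3 with hH
  set E := Module.End.eigenspace ((pull (diagonalAut f ha) 3).baseChange ℂ) c with hE
  -- the box counts
  set G : ℕ → ℕ := fun q ↦ if (q + 1) * d < 5 then 0 else
    (((univ : Finset (Fin 5)).finsuppAntidiag ((q + 1) * d - 5)).filter
      fun β : Fin 5 →₀ ℕ ↦ (∀ i, β i ≤ d - 2) ∧
        (∏ i, ((signInvolutionVector i : ℂˣ) : ℂ) ^ β i) = c).card with hG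
  -- symmetries of the box: `G 3 = G 0`, `G 2 = G 1`
  have hιι : signInvolutionVector * signInvolutionVector = 1 := signUnits_mul_self 2
  have hprod : ∏ i, ((signInvolutionVector i : ℂˣ) : ℂ) ^ (d - 2) = 1 := by
    rw [Finset.prod_pow, prod_signInvolutionVector, one_pow]
  have hG03 : G 3 = G 0 := by
    by_cases hd5 : d < 5
    · have hd4 : d = 4 := by omega
      simp only [hG, if_neg (show ¬ (3 + 1) * d < 5 by omega), if_pos (show (0 + 1) * d < 5 by omega)]
      exact card_boxFilter_eq_zero_of_lt _ _ (by omega)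
    · simp only [hG, if_neg (show ¬ (3 + 1) * d < 5 by omega), if_neg (show ¬ (0 + 1) * d < 5 by omega)]
      exact card_boxFilter_eq_of_add_eq hιι hprod c (by omega)
  have hG12 : G 2 = G 1 := by
    simp only [hG, if_neg (show ¬ (2 + 1) * d < 5 by omega), if_neg (show ¬ (1 + 1) * d < 5 by omega)]
    exact card_boxFilter_eq_of_add_eq hιι hprod c (by omega)
  -- the four blocks
  have h0 : Module.finrank ℂ ↥(E ⊓ H.piece 3 0) = G 0 :=
    finrank_signEigenspace_inf_piece_three_zero_of_geometricGenus hPG h4 f hf hns hXF ha c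
  have h3 : Module.finrank ℂ ↥(E ⊓ H.piece 0 3) = G 0 := by
    rw [hE, hH, finrank_eigenspace_inf_piece_symm exists_isReal_hodgeModel_holds hXF (diagonalAut f ha) 3 c 0 3, hconj]
    exact h0
  have h12 : Module.finrank ℂ ↥(E ⊓ H.piece 1 2) = Module.finrank ℂ ↥(E ⊓ H.piece 2 1) := by
    rw [hE, hH, finrank_eigenspace_inf_piece_symm exists_isReal_hodgeModel_holds hXF (diagonalAut f ha) 3 c 1 2, hconj]
  -- `dim E = Σ_q dim (E ∩ H^{3−q,q})`
  have htot := finrank_eigenspace_baseChange_pull_eq_sum exists_isReal_hodgeModel_holds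
    hodgePQ_independent_of_hodgeModel_holds hXF (diagonalAut f ha) 3 c
  rw [Finset.sum_range_succ, Finset.sum_range_succ, Finset.sum_range_succ, Finset.sum_range_succ,
    Finset.sum_range_zero, zero_add] at htot
  have e0 : H.piece (((3 : ℕ) : ℤ) - ((0 : ℕ) : ℤ)) ((0 : ℕ) : ℤ) = H.piece 3 0 := by norm_num
  have e1 : H.piece (((3 : ℕ) : ℤ) - ((1 : ℕ) : ℤ)) ((1 : ℕ) : ℤ) = H.piece 2 1 := by norm_num
  have e2 : H.piece (((3 : ℕ) : ℤ) - ((2 : ℕ) : ℤ)) ((2 : ℕ) : ℤ) = H.piece 1 2 := by norm_num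
  have e3 : H.piece (((3 : ℕ) : ℤ) - ((3 : ℕ) : ℤ)) ((3 : ℕ) : ℤ) = H.piece 0 3 := by norm_num
  have htot' : Module.finrank ℂ ↥E = Module.finrank ℂ ↥(E ⊓ H.piece 3 0) + Module.finrank ℂ ↥(E ⊓ H.piece 2 1) +
      Module.finrank ℂ ↥(E ⊓ H.piece 1 2) + Module.finrank ℂ ↥(E ⊓ H.piece 0 3) := by
    rw [← e0, ← e1, ← e2, ← e3]; exact htot
  -- `dim E = #{α ∈ 𝔄 : χ_α(ι) = c} = Σ_q G q`
  have hbetti : Module.finrank ℂ ↥E = G 0 + G 1 + G 2 + G 3 := by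
    rw [hE, finrank_signEigenspace_eq_card_admissible hd f hf hns hXF ha c,
      card_admissible_character_eq_sum_boxFilter h2 ⟨signInvolutionVector, signInvolutionVector_mem_fermatGroup hd⟩
        prod_signInvolutionVector c,
      Finset.sum_range_succ, Finset.sum_range_succ, Finset.sum_range_succ, Finset.sum_range_succ,
      Finset.sum_range_zero, zero_add]
  -- hence `dim (E ∩ H^{2,1}) = G 1`
  have h1 : Module.finrank ℂ ↥(E ⊓ H.piece 2 1) = G 1 := by omega
  -- the four cases
  obtain rfl | rfl | rfl | rfl : q = 0 ∨ q = 1 ∨ q = 2 ∨ q = 3 := by omega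
  · rw [show H.piece ((3 : ℤ) - ((0 : ℕ) : ℤ)) ((0 : ℕ) : ℤ) = H.piece 3 0 by norm_num]
    exact h0
  · rw [show H.piece ((3 : ℤ) - ((1 : ℕ) : ℤ)) ((1 : ℕ) : ℤ) = H.piece 2 1 by norm_num]
    exact h1
  · rw [show H.piece ((3 : ℤ) - ((2 : ℕ) : ℤ)) ((2 : ℕ) : ℤ) = H.piece 1 2 by norm_num, h12, h1]
    exact hG12.symm
  · rw [show H.piece ((3 : ℤ) - ((3 : ℕ) : ℤ)) ((3 : ℕ) : ℤ) = H.piece 0 3 by norm_num, h3]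
    exact hG03.symm

end Summit.HodgeConjecture.HodgeConjecture.Theorems.SignSymmetricPowersSignEigenHodgeOfGeometricGenus

end
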